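import Summits.RiemannHypothesis.RiemannHypothesis.Theorems.WeilWindowFlowWindowLipschitzStubFormDomainPos
import Summits.RiemannHypothesis.RiemannHypothesis.Theorems.OddSectorOddOneSignedWindowsGoodWindowsClosed
import Summits.RiemannHypothesis.RiemannHypothesis.Theorems.WeilGroundStateMarkovPartPositiveGroundStateDensityAux
import Literature.NumberTheory.LFunctions.WeilWindowSuzukiAsymptoticProofs
import HarnessLib

/-!
# Form-domain tools in the odd sector: odd mollification, dilation of window functions,
# continuity of increments and of the pole form
# (helper for crux `OddSector.OddOneSignedWindows`, item stmt-RiemannHypothesis-17778; RH-free)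

Support lemmas for `Theorems/OddSectorOddOneSignedWindowsFormDomainGroundState.lean` (a finite-
energy ODD window function sitting at the bottom of the closed form, `P(v) + 𝓔_a(v) ≤ M_a + ε_od(a)`,
IS an odd-sector ground state) — the tool that lets sign arguments fold or truncate a ground state
`u` DIRECTLY in the form domain and read the result as a ground state again. Normalisation of
`Literature/NumberTheory/LFunctions/WeilMarkovQuadratic.lean` (`D_t = weilIncrement`,
`P = weilPoleForm`) and `WeilDilationVirial.lean` (`g_η = weilDilate η g`,
`g_η(x) = (1+η)^{1/2} g((1+η)x)`).

## Contents (everything proved)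

* `exists_odd_mollified_seq`: an ODD `L²` function vanishing off `[-b, b]` is the `L²`-limit of odd
  TEST functions supported in `[-(b + 1/(n+1)), b + 1/(n+1)]` whose increments are dominated,
  `D_t(gₙ) ≤ D_t(f)` for all `t` (mollification by EVEN normalised bumps contracts increments —
  Young's inequality, `WeilGroundStateMarkovPart.weilIncrement_mollify_le` — and preserves oddness;
  the odd twin of `WeilGroundStateMarkovPart.exists_mollified_seq`, route WeilGroundState).
* `memLp_weilDilate`, `weilDilate_eq_zero_of_notMem`: dilates of window functions.
* `tendsto_integral_norm_sq_weilDilate_sub_of_memLp`: the dilation group is strongly continuous at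
  `η → 0⁺` on `L²` window functions (density of tests + unitarity).
* `continuous_weilIncrement_of_memLp`: `t ↦ D_t(f)` is continuous for `f ∈ L²` vanishing off a
  window (uniform approximation by the continuous `t ↦ D_t(gₙ)` of test functions).
* `tendsto_weilPoleForm_of_window`: the pole form is continuous along `L²`-convergent sequences
  living on a fixed window.

References: M. Fukushima, Y. Oshima, M. Takeda, *Dirichlet Forms and Symmetric Markov Processes*
(2011), §1.1 (cores of translation-invariant jump forms); E. Bombieri, Rend. Mat. Acc. Lincei (9)
11 (2000), §4 Thm 5 (the dilation).
-/

noncomputable section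

set_option linter.dupNamespace false

open MeasureTheory Set Filter ContinuousLinearMap
open scoped Topology ENNReal NNReal ComplexConjugate Convolution ArithmeticFunction.vonMangoldt

namespace Summit.RiemannHypothesis.RiemannHypothesis.Theorems.OddSector

open Literature.NumberTheory.LFunctions Literature.NumberTheory.LFunctions.ConnesVanSuijlekom
open Summit.RiemannHypothesis.RiemannHypothesis.Theorems.WeilGroundStateMarkovPart

/-! ### Odd mollification -/

/-- **Mollification by an even kernel preserves oddness**: for the (radial) normalised bump `K`
centred at `0` and an odd `f`, `K ⋆ f` is odd. [folklore] -/
theorem convolution_normed_neg_of_odd (φ : ContDiffBump (0 : ℝ)) {f : ℝ → ℂ}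
    (hfo : ∀ x, f (-x) = -f x) (x : ℝ) :
    (φ.normed volume ⋆[lsmul ℝ ℝ, volume] f) (-x) = -(φ.normed volume ⋆[lsmul ℝ ℝ, volume] f) x := by
  simp only [convolution_lsmul]
  rw [← integral_neg, ← integral_neg_eq_self]
  refine integral_congr_ae (Eventually.of_forall fun t ↦ ?_)
  simp only [φ.normed_neg, show -x - -t = -(x - t) by ring, hfo, smul_neg]

/-- **Odd mollified approximants of an odd window function.** For an odd `f ∈ L²` vanishing off
`[-b, b]`, the mollifications `gₙ = Kₙ ⋆ f` by normalised bumps of outer radius `1/(n+1)` are ODD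
test functions supported in `[-(b + 1/(n+1)), b + 1/(n+1)]`, with `D_t(gₙ) ≤ D_t(f)` for every `t`,
converging to `f` in `L²`. [folklore] -/
theorem exists_odd_mollified_seq {b : ℝ} {f : ℝ → ℂ} (hf : MemLp f 2)
    (hfs : ∀ x, x ∉ Icc (-b) b → f x = 0) (hfo : ∀ x, f (-x) = -f x) :
    ∃ g : ℕ → ℝ → ℂ,
      (∀ n, IsWeilTest (g n)) ∧ (∀ n x, g n (-x) = -g n x) ∧
      (∀ n, tsupport (g n) ⊆ Icc (-(b + 1 / ((n : ℝ) + 1))) (b + 1 / ((n : ℝ) + 1))) ∧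
      (∀ n t, weilIncrement (g n) t ≤ weilIncrement f t) ∧
      Tendsto (fun n ↦ ∫ x, ‖g n x - f x‖ ^ 2) atTop (𝓝 0) := by
  -- adapted from `WeilGroundStateMarkovPart.exists_mollified_seq`
  -- (Theorems/WeilGroundStateMarkovPartPositiveGroundStateDensityAux.lean), plus oddness
  set φ : ℕ → ContDiffBump (0 : ℝ) := fun n ↦
    ⟨1 / ((n : ℝ) + 2), 1 / ((n : ℝ) + 1), by positivity,
      one_div_lt_one_div_of_lt (by positivity) (by linarith)⟩
  have hrOut : ∀ n, (φ n).rOut = 1 / ((n : ℝ) + 1) := fun n ↦ rfl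
  have hfl : LocallyIntegrable f volume := hf.locallyIntegrable one_le_two
  have hfc : HasCompactSupport f := HasCompactSupport.intro isCompact_Icc hfs
  have hmem : ∀ n, MemLp ((φ n).normed volume ⋆[lsmul ℝ ℝ, volume] f) 2 volume := fun n ↦
    Literature.Analysis.UnboundedOperators.memLp_convolution_lsmul (φ n).integrable_normed hf
      one_le_two
  refine ⟨fun n ↦ (φ n).normed volume ⋆[lsmul ℝ ℝ, volume] f, fun n ↦ ⟨?_, ?_⟩,
    fun n x ↦ convolution_normed_neg_of_odd (φ n) hfo x, fun n ↦ ?_,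
    fun n t ↦ weilIncrement_mollify_le (φ n) hf t, ?_⟩
  · exact ((φ n).hasCompactSupport_normed (μ := volume)).contDiff_convolution_left _
      (φ n).contDiff_normed hfl
  · exact ((φ n).hasCompactSupport_normed (μ := volume)).convolution _ hfc
  · refine closure_minimal (fun x hx ↦ ?_) isClosed_Icc
    obtain ⟨y, hy, z, hz, rfl⟩ := support_convolution_subset (L := lsmul ℝ ℝ) (μ := volume)
      (f := (φ n).normed volume) (g := f) hx
    rw [(φ n).support_normed_eq, hrOut, Metric.mem_ball, dist_zero_right, Real.norm_eq_abs,
      abs_lt] at hy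
    have hz' : z ∈ Icc (-b) b := not_not.1 fun h ↦ hz (hfs z h)
    constructor <;> linarith [hz'.1, hz'.2, hy.1, hy.2]
  · have hT := Literature.Analysis.FunctionSpaces.tendsto_eLpNorm_normed_convolution_sub_self
      (μ := volume) (φ := φ) (l := atTop)
      (tendsto_one_div_add_atTop_nhds_zero_nat (𝕜 := ℝ)) one_le_two ENNReal.ofNat_ne_top hf
    have hT' : Tendsto (fun n ↦ Real.sqrt
        (∫ x, ‖((φ n).normed volume ⋆[lsmul ℝ ℝ, volume] f) x - f x‖ ^ 2)) atTop (𝓝 0) := by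
      have h2 := (ENNReal.tendsto_toReal ENNReal.zero_ne_top).comp hT
      rw [ENNReal.toReal_zero] at h2
      refine h2.congr fun n ↦ ?_
      rw [Function.comp_apply, eLpNorm_two_eq_ofReal_sqrt ((hmem n).sub hf),
        ENNReal.toReal_ofReal (Real.sqrt_nonneg _)]
      rfl
    have h3 := hT'.pow 2
    rw [zero_pow two_ne_zero] at h3
    refine h3.congr fun n ↦ ?_
    exact Real.sq_sqrt (integral_nonneg fun _ ↦ by positivity)

/-! ### Dilates of window functions -/

/-- **Dilates of `L²` functions are in `L²`** (`x ↦ (1+η)x` scales Lebesgue measure, `η > -1`).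
[folklore] -/
theorem memLp_weilDilate {f : ℝ → ℂ} (hf : MemLp f 2) {η : ℝ} (hη : -1 < η) :
    MemLp (weilDilate η f) 2 := by
  have hc : (1 + η) ≠ 0 := by linarith
  have h1 : MemLp f 2 (Measure.map (fun x : ℝ ↦ (1 + η) * x) volume) := by
    rw [Real.map_volume_mul_left hc]
    exact hf.smul_measure ENNReal.ofReal_ne_top
  have h2 : MemLp (fun x : ℝ ↦ f ((1 + η) * x)) 2 volume :=
    h1.comp_of_map (measurable_const_mul _).aemeasurable
  exact h2.const_mul _

/-- A dilate of a function vanishing off `[-a, a]` vanishes off `[-a/(1+η), a/(1+η)]` (`η > -1`).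
[folklore] -/
theorem weilDilate_eq_zero_of_notMem {f : ℝ → ℂ} {a η : ℝ} (hη : -1 < η)
    (hfs : ∀ x, x ∉ Icc (-a) a → f x = 0) {x : ℝ} (hx : x ∉ Icc (-(a / (1 + η))) (a / (1 + η))) :
    weilDilate η f x = 0 := by
  have hc : 0 < 1 + η := by linarith
  rw [weilDilate_apply, hfs _ fun hm ↦ hx ?_, mul_zero]
  rw [mem_Icc] at hm ⊢
  constructor
  · rw [neg_le, le_div_iff₀ hc]; nlinarith [hm.1]
  · rw [le_div_iff₀ hc]; nlinarith [hm.2]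

/-- **The dilation group is strongly continuous at `η → 0⁺` on `L²` window functions**: for
`f ∈ L²` vanishing off `[-b, b]` and `0 ≤ ηₙ ≤ 1`, `ηₙ → 0`, `∫|f_{ηₙ} − f|² → 0` (approximate `f`
by a test function `g`; `‖f_η − f‖ ≤ 2‖f − g‖ + ‖g_η − g‖` by unitarity). [folklore] -/
theorem tendsto_integral_norm_sq_weilDilate_sub_of_memLp {b : ℝ} {f : ℝ → ℂ} (hf : MemLp f 2)
    (hfs : ∀ x, x ∉ Icc (-b) b → f x = 0) (hfo : ∀ x, f (-x) = -f x) {η : ℕ → ℝ}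
    (hη0 : ∀ n, 0 ≤ η n) (hη1 : ∀ n, η n ≤ 1) (hη : Tendsto η atTop (𝓝 0)) :
    Tendsto (fun n ↦ ∫ x, ‖weilDilate (η n) f x - f x‖ ^ 2) atTop (𝓝 0) := by
  obtain ⟨g, hgt, -, -, -, hglim⟩ := exists_odd_mollified_seq hf hfs hfo
  have hηm1 : ∀ n, -1 < η n := fun n ↦ by linarith [hη0 n]
  have hgm : ∀ m, MemLp (g m) 2 := fun m ↦ (hgt m).memLp_two
  -- three-epsilon bound through a fixed `g m`
  have hbnd : ∀ n m, ∫ x, ‖weilDilate (η n) f x - f x‖ ^ 2 ≤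
      (8 * ∫ x, ‖g m x - f x‖ ^ 2) + 4 * ∫ x, ‖weilDilate (η n) (g m) x - g m x‖ ^ 2 := by
    intro n m
    have hfd : MemLp (weilDilate (η n) f) 2 := memLp_weilDilate hf (hηm1 n)
    have hgd : MemLp (weilDilate (η n) (g m)) 2 := memLp_weilDilate (hgm m) (hηm1 n)
    have s1 := integral_norm_sq_add_le (hfd.sub hgd) (hgd.sub hf)
    have e1 : (fun x ↦ ‖(weilDilate (η n) f - weilDilate (η n) (g m)) x + (weilDilate (η n) (g m) - f) x‖ ^ 2)
        = fun x ↦ ‖weilDilate (η n) f x - f x‖ ^ 2 := by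
      funext x; simp only [Pi.sub_apply, sub_add_sub_cancel]
    have e2 : ∫ x, ‖(weilDilate (η n) f - weilDilate (η n) (g m)) x‖ ^ 2 = ∫ x, ‖g m x - f x‖ ^ 2 := by
      have : (weilDilate (η n) f - weilDilate (η n) (g m)) =
          weilDilate (η n) (fun t ↦ f t - g m t) := by rw [weilDilate_sub]; rfl
      rw [this, integral_norm_sq_weilDilate _ (hηm1 n)]
      exact integral_congr_ae (Eventually.of_forall fun x ↦ by
        beta_reduce; rw [← norm_neg, neg_sub])
    rw [e1, e2] at s1
    have s2 := integral_norm_sq_add_le (hgd.sub (hgm m)) ((hgm m).sub hf)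
    have e3 : (fun x ↦ ‖(weilDilate (η n) (g m) - g m) x + (g m - f) x‖ ^ 2) =
        fun x ↦ ‖(weilDilate (η n) (g m) - f) x‖ ^ 2 := by
      funext x; simp only [Pi.sub_apply, sub_add_sub_cancel]
    rw [e3] at s2
    simp only [Pi.sub_apply] at s1 s2 ⊢
    have hA : 0 ≤ ∫ x, ‖g m x - f x‖ ^ 2 := integral_nonneg fun _ ↦ by positivity
    linarith
  rw [Metric.tendsto_atTop]
  intro ε hε
  obtain ⟨m, hm⟩ : ∃ m, ∫ x, ‖g m x - f x‖ ^ 2 < ε / 16 :=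
    ((Metric.tendsto_atTop.1 hglim) (ε / 16) (by positivity)).imp fun m h ↦ by
      have := h m le_rfl
      rwa [Real.dist_eq, sub_zero, abs_of_nonneg (integral_nonneg fun _ ↦ by positivity)] at this
  obtain ⟨N, hN⟩ := (Metric.tendsto_atTop.1
    (tendsto_integral_norm_sq_weilDilate_sub (hgt m) hη0 hη1 hη)) (ε / 8) (by positivity)
  refine ⟨N, fun n hn ↦ ?_⟩
  have h2 := hN n hn
  rw [Real.dist_eq, sub_zero, abs_of_nonneg (integral_nonneg fun _ ↦ by positivity)] at h2 ⊢
  linarith [hbnd n m]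

/-! ### Continuity of increments in the jump length for `L²` window functions -/

/-- Reverse triangle inequality for `L²` norms: `|‖F‖₂ − ‖G‖₂| ≤ ‖F − G‖₂`. [folklore] -/
theorem abs_sqrt_integral_norm_sq_sub_sqrt_le {F G : ℝ → ℂ} (hF : MemLp F 2) (hG : MemLp G 2) :
    |Real.sqrt (∫ x, ‖F x‖ ^ 2) - Real.sqrt (∫ x, ‖G x‖ ^ 2)| ≤
      Real.sqrt (∫ x, ‖F x - G x‖ ^ 2) := by
  have h1 := sqrt_integral_norm_sq_sub_le hF (hF.sub hG)
  have h2 := sqrt_integral_norm_sq_sub_le hG (hG.sub hF)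
  simp only [Pi.sub_apply, sub_sub_cancel] at h1 h2
  have e3 : (∫ t, ‖G t - F t‖ ^ 2) = ∫ t, ‖F t - G t‖ ^ 2 :=
    integral_congr_ae (Eventually.of_forall fun t ↦ by beta_reduce; rw [← norm_neg, neg_sub])
  rw [e3] at h2
  rw [abs_le]
  constructor <;> linarith

/-- **`t ↦ D_t(f)` is continuous** for `f ∈ L²` vanishing off a window (and odd — the parity is
only used to pick the approximants from `exists_odd_mollified_seq`): `√D_t` is the uniform limit of
the continuous `√D_t(gₙ)` of test functions `gₙ → f`, since the increment map is `2`-Lipschitz in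
`L²` (`integral_norm_sq_increment_sub_le`). [folklore] -/
theorem continuous_weilIncrement_of_memLp {b : ℝ} {f : ℝ → ℂ} (hf : MemLp f 2)
    (hfs : ∀ x, x ∉ Icc (-b) b → f x = 0) (hfo : ∀ x, f (-x) = -f x) :
    Continuous (weilIncrement f) := by
  obtain ⟨g, hgt, -, -, -, hglim⟩ := exists_odd_mollified_seq hf hfs hfo
  have hgm : ∀ m, MemLp (g m) 2 := fun m ↦ (hgt m).memLp_two
  -- `√D_t(g m) → √D_t(f)` uniformly in `t`
  have hunif : TendstoUniformly (fun m t ↦ Real.sqrt (weilIncrement (g m) t))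
      (fun t ↦ Real.sqrt (weilIncrement f t)) atTop := by
    rw [Metric.tendstoUniformly_iff]
    intro ε hε
    have hev : ∀ᶠ m in atTop, ∫ x, ‖g m x - f x‖ ^ 2 < (ε / 2) ^ 2 / 4 :=
      hglim.eventually (eventually_lt_nhds (by positivity))
    filter_upwards [hev] with m hm t
    -- `|√D_t(f) − √D_t(g)| ≤ √(∫|(f(·+t) − f) − (g(·+t) − g)|²) ≤ 2‖f − g‖₂`
    have hF : MemLp (fun x ↦ f (x + t) - f x) 2 :=
      (hf.comp_measurePreserving (measurePreserving_add_right volume t)).sub hf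
    have hG : MemLp (fun x ↦ g m (x + t) - g m x) 2 :=
      ((hgm m).comp_measurePreserving (measurePreserving_add_right volume t)).sub (hgm m)
    have h1 := abs_sqrt_integral_norm_sq_sub_sqrt_le hF hG
    have h2 := integral_norm_sq_increment_sub_le hf (hgm m) t
    rw [Real.dist_eq]
    unfold weilIncrement
    have h3 : Real.sqrt (∫ x, ‖(f (x + t) - f x) - (g m (x + t) - g m x)‖ ^ 2) ≤
        Real.sqrt (4 * ∫ x, ‖f x - g m x‖ ^ 2) := Real.sqrt_le_sqrt h2
    have h4 : Real.sqrt (4 * ∫ x, ‖f x - g m x‖ ^ 2) < ε := by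
      have e : ∫ x, ‖f x - g m x‖ ^ 2 = ∫ x, ‖g m x - f x‖ ^ 2 :=
        integral_congr_ae (Eventually.of_forall fun x ↦ by beta_reduce; rw [← norm_neg, neg_sub])
      rw [e, Real.sqrt_lt' hε]
      nlinarith [hm, hε]
    have h1' := (abs_sub_comm _ _).trans_le h1
    linarith [h1, h1', h3, h4]
  have hcont : Continuous fun t ↦ Real.sqrt (weilIncrement f t) :=
    hunif.continuous (Eventually.of_forall fun m ↦
      (continuous_weilIncrement (hgt m)).sqrt).frequently
  have e : weilIncrement f = fun t ↦ (Real.sqrt (weilIncrement f t)) ^ 2 := by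
    funext t; rw [Real.sq_sqrt (weilIncrement_nonneg f t)]
  rw [e]
  exact hcont.pow 2

/-! ### Continuity of the pole form along `L²`-convergent window sequences -/

/-- Pairings with a continuous real weight converge along an `L²`-convergent sequence of functions
living on a fixed window. [folklore] -/
theorem tendsto_integral_mul_ofReal_of_window {R : ℝ} {f : ℝ → ℂ} {g : ℕ → ℝ → ℂ}
    (hf : MemLp f 2) (hg : ∀ n, MemLp (g n) 2) (hfR : ∀ x, x ∉ Icc (-R) R → f x = 0)
    (hgR : ∀ n x, x ∉ Icc (-R) R → g n x = 0)
    (hlim : Tendsto (fun n ↦ ∫ x, ‖g n x - f x‖ ^ 2) atTop (𝓝 0)) {w : ℝ → ℝ}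
    (hw : Continuous w) :
    Tendsto (fun n ↦ ∫ x, g n x * (w x : ℂ)) atTop (𝓝 (∫ x, f x * (w x : ℂ))) := by
  -- adapted from the private `tendsto_integral_mul_ofReal` of
  -- Theorems/WeilWindowFlowWindowLipschitzStubFormDomainPos.lean (route WeilWindowFlow)
  set u : ℝ → ℂ := (Icc (-R) R).indicator fun x ↦ ((w x : ℝ) : ℂ) with hu
  have hwc : Continuous fun x : ℝ ↦ ((w x : ℝ) : ℂ) := Complex.continuous_ofReal.comp hw
  obtain ⟨C, hC⟩ := (isCompact_Icc (a := -R) (b := R)).exists_bound_of_continuousOn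
    hwc.continuousOn
  have hum : MemLp u 2 volume := by
    rw [hu, memLp_indicator_iff_restrict measurableSet_Icc]
    exact MemLp.of_bound hwc.aestronglyMeasurable C
      ((ae_restrict_iff' measurableSet_Icc).2 (Eventually.of_forall hC))
  have key : ∀ v : ℝ → ℂ, (∀ x, x ∉ Icc (-R) R → v x = 0) →
      (fun x ↦ v x * (w x : ℂ)) = fun x ↦ v x * conj (u x) := by
    intro v hv
    funext x
    by_cases hx : x ∈ Icc (-R) R
    · rw [hu, indicator_of_mem hx, Complex.conj_ofReal]
    · rw [hv x hx, zero_mul, zero_mul]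
  have hgk : (fun n ↦ ∫ x, g n x * (w x : ℂ)) = fun n ↦ ∫ x, g n x * conj (u x) :=
    funext fun n ↦ by rw [key (g n) (hgR n)]
  rw [hgk, key f hfR]
  exact tendsto_integral_mul_conj_left hum hf hg hlim

/-- **The pole form is continuous along `L²`-convergent sequences on a fixed window.**
[folklore] -/
theorem tendsto_weilPoleForm_of_window {R : ℝ} {f : ℝ → ℂ} {g : ℕ → ℝ → ℂ} (hf : MemLp f 2)
    (hg : ∀ n, MemLp (g n) 2) (hfR : ∀ x, x ∉ Icc (-R) R → f x = 0)
    (hgR : ∀ n x, x ∉ Icc (-R) R → g n x = 0)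
    (hlim : Tendsto (fun n ↦ ∫ x, ‖g n x - f x‖ ^ 2) atTop (𝓝 0)) :
    Tendsto (fun n ↦ weilPoleForm (g n)) atTop (𝓝 (weilPoleForm f)) := by
  have hc := tendsto_integral_mul_ofReal_of_window hf hg hfR hgR hlim
    (w := fun x ↦ Real.cosh (x / 2)) (by fun_prop)
  have hs := tendsto_integral_mul_ofReal_of_window hf hg hfR hgR hlim
    (w := fun x ↦ Real.sinh (x / 2)) (by fun_prop)
  unfold weilPoleForm
  exact ((hc.norm.pow 2).const_mul 2).sub ((hs.norm.pow 2).const_mul 2)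

/-- **Registered form** (sub-goal `odd_mollified_seq_exists` of item stmt-RiemannHypothesis-17778):
odd `L²` window functions are `L²`-limits of odd test functions on slightly larger windows with
dominated increments. [folklore] -/
theorem odd_mollified_seq_exists :
    ∀ (b : ℝ) (f : ℝ → ℂ), MemLp f 2 → (∀ x, x ∉ Icc (-b) b → f x = 0) → (∀ x, f (-x) = -f x) →
      ∃ g : ℕ → ℝ → ℂ, (∀ n, IsWeilTest (g n)) ∧ (∀ n x, g n (-x) = -g n x) ∧
        (∀ n, tsupport (g n) ⊆ Icc (-(b + 1 / ((n : ℝ) + 1))) (b + 1 / ((n : ℝ) + 1))) ∧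
        (∀ n t, weilIncrement (g n) t ≤ weilIncrement f t) ∧
        Tendsto (fun n ↦ ∫ x, ‖g n x - f x‖ ^ 2) atTop (𝓝 0) :=
  fun _ _ hf hfs hfo ↦ exists_odd_mollified_seq hf hfs hfo

end Summit.RiemannHypothesis.RiemannHypothesis.Theorems.OddSector

end
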